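import Mathlib
import Summits.Ventures.PercRepro2.Defs
import Summits.Ventures.PercRepro2.Harris
import Summits.Ventures.PercRepro2.CoinDefs
import Summits.Ventures.PercRepro2.CoinReverse
import Summits.Ventures.PercRepro2.CoinLsmCoreAlg
import Summits.Ventures.PercRepro2.CoinLsmCoreDefs

/-!
# The two cell masses of a closed-in core as event probabilities (blind cell PercRepro2, night-2 g7;
proofs/NIGHT2-DARC.md §30.11)

`M₀ = Σ_{W ∌ u} ν W · A W = P(R_{t,u})` and `M' = Σ_{W ∋ u} ν W · A (W ∪ {w}) = P(gate ∩ {u ∈ S⁺})`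
(`cell_masses`), via `E[f; B ∩ A] = E[1_B · f; A]` (`massE_inter_left`) and the core mass
decomposition with the indicator of `u ∈ S⁺` folded into the level constant.
-/

namespace Summit.Ventures.PercRepro2.Coin

open Classical

section CellMasses

variable {V : Type*} {E : Type*} [Fintype V] [DecidableEq V] [Fintype E] [DecidableEq E]
  {R : Type*} [Field R] [LinearOrder R] [IsStrictOrderedRing R]
  {arcs : E → Finset (V × V)} {s : V} {C : Finset V}

omit [Fintype V] [DecidableEq V] [LinearOrder R] [IsStrictOrderedRing R] in
/-- `E[f; B ∩ A] = E[1_B · f; A]`. -/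
lemma massE_inter_left (p : E → R) (f : Config E → R) (A B : Set (Config E)) :
    massE p f (B ∩ A) = massE p (fun ω => B.indicator 1 ω * f ω) A := by
  unfold massE
  congr 1
  ext ω
  by_cases hA : ω ∈ A <;> by_cases hB : ω ∈ B <;> simp [Set.indicator, hA, hB]

omit [Fintype V] [LinearOrder R] [IsStrictOrderedRing R] in
/-- The two cell masses as event probabilities: `M₀ = P(R_{t,u})` and
`M' = P(gate ∩ {u ∈ S⁺})`. -/
theorem ClosedInCore.cell_masses (h : ClosedInCore arcs s C) (p : E → R) (hS : SameEnds arcs)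
    {t : V} (htC : t ∉ C) (hts : t ≠ s) {u w : V} (hu : u ∈ C) (hws : w ≠ s) (hwC : w ∉ C) :
    prob p (avoidEvent arcs s (insert u {t})) =
      ∑ W ∈ C.powerset, prob p (coreLevel arcs s C W) * notMemWt u W *
        prob p (coreAvoidEvent arcs s t C W) ∧
    prob p (gateEvent arcs s {t} u w ∩ fwdEvent arcs s u) =
      ∑ W ∈ C.powerset, prob p (coreLevel arcs s C W) * memWt u W *
        prob p (coreAvoidEvent arcs s t C (insert w W)) := by
  have hR := h.avoid_eq_biUnion hS htC hts
  have hG := h.gate_eq_biUnion hS htC hts hu hwC hws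
  -- the indicators of `u ∉ S⁺` / `u ∈ S⁺` on a level
  have hnot : ∀ W ⊆ C, ∀ ω ∈ coreLevel arcs s C W,
      (fwdEvent arcs s u)ᶜ.indicator (1 : Config E → R) ω * (fun _ => (1 : R)) ω =
        notMemWt u W := by
    intro W _ ω hω
    have hmem : ω ∈ fwdEvent arcs s u ↔ u ∈ W := by
      simp only [fwdEvent, Set.mem_setOf_eq]
      exact (mem_coreLevel.mp hω u hu).symm
    simp only [notMemWt, mul_one]
    by_cases huW : u ∈ W
    · have hn : ω ∉ (fwdEvent arcs s u)ᶜ := fun h' => h' (hmem.mpr huW)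
      rw [if_pos huW, Set.indicator_of_notMem hn]
    · have hm : ω ∈ (fwdEvent arcs s u)ᶜ := fun h' => huW (hmem.mp h')
      rw [if_neg huW, Set.indicator_of_mem hm]; rfl
  have hmem' : ∀ W ⊆ C, ∀ ω ∈ coreLevel arcs s C W,
      (fwdEvent arcs s u).indicator (1 : Config E → R) ω * (fun _ => (1 : R)) ω = memWt u W := by
    intro W _ ω hω
    have hmem : ω ∈ fwdEvent arcs s u ↔ u ∈ W := by
      simp only [fwdEvent, Set.mem_setOf_eq]
      exact (mem_coreLevel.mp hω u hu).symm
    simp only [memWt, mul_one]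
    by_cases huW : u ∈ W
    · rw [if_pos huW, Set.indicator_of_mem (hmem.mpr huW)]; rfl
    · rw [if_neg huW, Set.indicator_of_notMem (fun h' => huW (hmem.mp h'))]
  constructor
  · rw [avoidEvent_insert, prob_eq_massE_one, massE_inter_left, hR,
      h.core_mass p t (fun W => W) (g := fun W => notMemWt u W) hnot]
    exact Finset.sum_congr rfl fun W _ => by ring
  · rw [Set.inter_comm, prob_eq_massE_one, massE_inter_left, hG,
      h.core_mass p t (starTarget u w) (g := fun W => memWt u W) hmem']
    refine Finset.sum_congr rfl fun W hW => ?_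
    by_cases huW : u ∈ W
    · simp [starTarget, memWt, huW]
    · simp [memWt, huW]


end CellMasses

end Summit.Ventures.PercRepro2.Coin
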